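import Literature.AnabelianGeometry.SemiGraphs.FreeProPRankTwoGluing
import Literature.AnabelianGeometry.SemiGraphs.ThetaRayElevated
import Literature.AnabelianGeometry.SemiGraphs.CharacteristicOpenCore
import Literature.NumberTheory.GaloisRepresentations.LocalOneUnitsProofs
import HarnessLib

/-!
# `F̂₂⁽ᵖ⁾`: surjectivity of the abelianisation, characteristic open cores under `θₙ`, and the
# level-`pᵉ` characters `F̂₂⁽ᵖ⁾ → (ℤ/pᵉ)²`

Third part of brick R1 "THE GROUP" (abc-iut cell, L3 FRONTIER programme «REFUTE-F1732»; sequel to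
`FreeProPRankTwo.lean`, `FreeProPRankTwoGluing.lean`).  Classical objects only (Ribes–Zalesskii,
*Profinite Groups*, §3.3 free pro-`p` groups; Dixon–du Sautoy–Mann–Segal, *Analytic pro-`p` groups*,
Prop. 1.6 characteristic open subgroups), DERIVED from the tree:

* `ab_surjective` — the continuous abelianisation `F̂₂⁽ᵖ⁾ → ℤ_p × ℤ_p` is surjective (compact image
  containing `(1,0)`, `(0,1)`: abc-iut-w6-d102's `surjective_of_ofAdd_one_zero_mem_of_ofAdd_zero_one_mem`);
* `map_charOpenCore_θ` — the Nielsen automorphisms `θₙ` preserve every characteristic open core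
  `G(d) = charOpenCore (Grp p) d` (the tree's `map_charOpenCore_eq`), which is open of finite index;
* `abMod e : F̂₂⁽ᵖ⁾ → (ℤ/pᵉ)²` and the level character `χaMod e : F̂₂⁽ᵖ⁾ → ℤ/pᵉ` (`a ↦ 1`, `b ↦ 0`),
  continuous for the discrete topology, with their values on `a`, `b`, on the gluing `α` and on `θₙ`;
  in particular `θₙ ≡ id` on the gluing image at every level `e ≤ n` (`abMod_θ_α_of_le`) and `χaMod e`
  is `θₙ`-invariant (`χaMod_θ`).

Honest framing: classical group theory; nothing here bears on [IUTchIII] Cor. 3.12; typed ≠ proved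
elsewhere. [cite: RibesZalesskii2010, §3.3]
-/

noncomputable section

open Topology Filter Multiplicative
open Literature.AnabelianGeometry.AbsoluteAnabelian (IsTopologicallyFinitelyGenerated)
open Literature.NumberTheory.GaloisRepresentations (OneUnits.continuous_toZModPow)

namespace Literature.AnabelianGeometry.SemiGraphs.FreeProPRankTwo

variable (p : ℕ)

/-! ### The Nielsen automorphisms preserve the characteristic open cores -/

/-- **`θₙ(G(d)) = G(d)`** for the characteristic open core `G(d) = charOpenCore (Grp p) d` (a
bi-continuous automorphism permutes the open subgroups of each index). [cite: DixonEtAl1999, Prop 1.6] -/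
theorem map_charOpenCore_θ (n d : ℕ) :
    (charOpenCore (Grp p) d).map (θ p n).toMulEquiv.toMonoidHom = charOpenCore (Grp p) d :=
  map_charOpenCore_eq (θ p n).toMulEquiv (θ p n).continuous (θ p n).symm.continuous

/-- `θₙ g ∈ G(d) ↔ g ∈ G(d)`. [cite: DixonEtAl1999, Prop 1.6] -/
theorem θ_mem_charOpenCore_iff (n d : ℕ) (g : Grp p) :
    θ p n g ∈ charOpenCore (Grp p) d ↔ g ∈ charOpenCore (Grp p) d := by
  constructor
  · intro h
    have h' : θ p n g ∈ (charOpenCore (Grp p) d).map (θ p n).toMulEquiv.toMonoidHom := by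
      rw [map_charOpenCore_θ]
      exact h
    obtain ⟨g', hg', hgg'⟩ := h'
    have : g' = g := (θ p n).injective hgg'
    exact this ▸ hg'
  · intro h
    rw [← map_charOpenCore_θ p n d]
    exact ⟨g, h, rfl⟩

/-- The characteristic open cores of `F̂₂⁽ᵖ⁾` are open. [cite: DixonEtAl1999, Prop 1.6] -/
theorem isOpen_charOpenCore (d : ℕ) : IsOpen (charOpenCore (Grp p) d : Set (Grp p)) :=
  isOpen_charOpenCore_of_tfg (isTopologicallyFinitelyGenerated p) d

/-- The characteristic open cores of `F̂₂⁽ᵖ⁾` have finite index. [cite: DixonEtAl1999, Prop 1.6] -/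
theorem finiteIndex_charOpenCore (d : ℕ) : (charOpenCore (Grp p) d).FiniteIndex :=
  finiteIndex_charOpenCore_of_tfg (isTopologicallyFinitelyGenerated p) d

/-- The characteristic open cores of `F̂₂⁽ᵖ⁾` are normal. [cite: DixonEtAl1999, Prop 1.6] -/
theorem normal_charOpenCore (d : ℕ) : (charOpenCore (Grp p) d).Normal :=
  charOpenCore_normal d

variable [hp : Fact p.Prime]

/-! ### Surjectivity of the abelianisation and of the characters -/

/-- **`ab : F̂₂⁽ᵖ⁾ → ℤ_p × ℤ_p` is surjective.** [cite: RibesZalesskii2010, §3.3] -/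
theorem ab_surjective : Function.Surjective (ab p) :=
  ProfiniteSemiGraph.surjective_of_ofAdd_one_zero_mem_of_ofAdd_zero_one_mem p (ab p).toMonoidHom
    (ab p).continuous ⟨a p, ab_a p⟩ ⟨b p, ab_b p⟩

/-- `χ_a` is surjective (`χ_a ∘ α = id`). [cite: RibesZalesskii2010, §3.3] -/
theorem χa_surjective : Function.Surjective (χa p) := fun t => ⟨α p t, χa_α p t⟩

/-- `χ_b ∘ zpow b = id`. [cite: RibesZalesskii2010, §4.1] -/
@[simp] theorem χb_zpow_b (t : Multiplicative ℤ_[p]) : χb p (zpow p (b p) t) = t := by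
  have h : (χb p).comp (zpow p (b p)) = ContinuousMonoidHom.id _ :=
    padicInt_continuousMonoidHom_ext p (by simp)
  exact DFunLike.congr_fun h t

/-- `χ_a ∘ zpow b = 0`. [cite: RibesZalesskii2010, §4.1] -/
@[simp] theorem χa_zpow_b (t : Multiplicative ℤ_[p]) : χa p (zpow p (b p) t) = 1 := by
  let triv : Multiplicative ℤ_[p] →ₜ* Multiplicative ℤ_[p] :=
    { toMonoidHom := 1, continuous_toFun := continuous_const }
  have h : (χa p).comp (zpow p (b p)) = triv :=
    padicInt_continuousMonoidHom_ext p (by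
      change χa p (zpow p (b p) (ofAdd 1)) = 1
      simp)
  exact DFunLike.congr_fun h t

/-- `χ_b` is surjective. [cite: RibesZalesskii2010, §3.3] -/
theorem χb_surjective : Function.Surjective (χb p) := fun t => ⟨zpow p (b p) t, χb_zpow_b p t⟩

/-! ### Level-`pᵉ` abelianisation and characters -/

/-- **The level-`pᵉ` abelianisation** `abMod e : F̂₂⁽ᵖ⁾ → ℤ/pᵉ × ℤ/pᵉ` (reduction of `ab` modulo `pᵉ`;
continuous for the discrete topology). [cite: RibesZalesskii2010, §3.3] -/
def abMod (e : ℕ) : Grp p →ₜ* Multiplicative (ZMod (p ^ e) × ZMod (p ^ e)) where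
  toFun g := ofAdd (PadicInt.toZModPow e (ab p g).toAdd.1, PadicInt.toZModPow e (ab p g).toAdd.2)
  map_one' := by simp
  map_mul' x y := by
    simp only [map_mul, toAdd_mul, Prod.fst_add, Prod.snd_add, map_add, ← ofAdd_add, Prod.mk_add_mk]
  continuous_toFun := by
    apply continuous_ofAdd.comp
    have hc : Continuous fun g : Grp p => (ab p g).toAdd := continuous_toAdd.comp (ab p).continuous
    exact ((OneUnits.continuous_toZModPow p e).comp (continuous_fst.comp hc)).prodMk
      ((OneUnits.continuous_toZModPow p e).comp (continuous_snd.comp hc))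

/-- Formula for `abMod`. [cite: RibesZalesskii2010, §3.3] -/
theorem abMod_apply (e : ℕ) (g : Grp p) :
    abMod p e g = ofAdd (PadicInt.toZModPow e (ab p g).toAdd.1, PadicInt.toZModPow e (ab p g).toAdd.2) :=
  rfl

/-- `abMod e a = (1, 0)`. [cite: RibesZalesskii2010, §3.3] -/
@[simp] theorem abMod_a (e : ℕ) : abMod p e (a p) = ofAdd (1, 0) := by
  simp [abMod_apply]

/-- `abMod e b = (0, 1)`. [cite: RibesZalesskii2010, §3.3] -/
@[simp] theorem abMod_b (e : ℕ) : abMod p e (b p) = ofAdd (0, 1) := by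
  simp [abMod_apply]

/-- `abMod e (α t) = (t mod pᵉ, 0)`. [cite: RibesZalesskii2010, §3.3] -/
theorem abMod_α (e : ℕ) (t : Multiplicative ℤ_[p]) :
    abMod p e (α p t) = ofAdd (PadicInt.toZModPow e t.toAdd, 0) := by
  rw [abMod_apply, ab_α, toAdd_ofAdd, map_zero]

/-- **`θₙ` at level `pᵉ` is the shear `(u, v) ↦ (u, v + pⁿ u)`.** [cite: RibesZalesskii2010, §3.3] -/
theorem abMod_θ (e n : ℕ) (g : Grp p) :
    abMod p e (θ p n g) =
      ofAdd ((abMod p e g).toAdd.1, (abMod p e g).toAdd.2 + (p : ZMod (p ^ e)) ^ n * (abMod p e g).toAdd.1) := by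
  rw [abMod_apply, abMod_apply, ab_θ, toAdd_ofAdd, toAdd_ofAdd, map_add, map_mul, map_pow, map_natCast]

/-- `abMod e (θₙ (α t)) = (t̄, pⁿ t̄)`. [cite: RibesZalesskii2010, §3.3] -/
theorem abMod_θ_α (e n : ℕ) (t : Multiplicative ℤ_[p]) :
    abMod p e (θ p n (α p t)) =
      ofAdd (PadicInt.toZModPow e t.toAdd, (p : ZMod (p ^ e)) ^ n * PadicInt.toZModPow e t.toAdd) := by
  rw [abMod_θ, abMod_α, toAdd_ofAdd, zero_add]

/-- **`θₙ ≡ id` on the gluing image at every level `e ≤ n`**: `abMod e (θₙ (α t)) = abMod e (α t)`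
(`pⁿ = 0` in `ℤ/pᵉ`). [cite: RibesZalesskii2010, §3.3] -/
theorem abMod_θ_α_of_le {e n : ℕ} (h : e ≤ n) (t : Multiplicative ℤ_[p]) :
    abMod p e (θ p n (α p t)) = abMod p e (α p t) := by
  rw [abMod_θ_α, abMod_α]
  have hpn : (p : ZMod (p ^ e)) ^ n = 0 := by
    obtain ⟨k, rfl⟩ := Nat.exists_eq_add_of_le h
    rw [pow_add, ← Nat.cast_pow, ZMod.natCast_self, zero_mul]
  rw [hpn, zero_mul]

/-- `θₙ ≡ id` modulo `pᵉ` on the whole group iff... (one direction, the one used): for `e ≤ n`,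
`abMod e ∘ θₙ = abMod e`. [cite: RibesZalesskii2010, §3.3] -/
theorem abMod_θ_of_le {e n : ℕ} (h : e ≤ n) (g : Grp p) : abMod p e (θ p n g) = abMod p e g := by
  rw [abMod_θ]
  have hpn : (p : ZMod (p ^ e)) ^ n = 0 := by
    obtain ⟨k, rfl⟩ := Nat.exists_eq_add_of_le h
    rw [pow_add, ← Nat.cast_pow, ZMod.natCast_self, zero_mul]
  rw [hpn, zero_mul, add_zero]
  rfl

/-- `abMod e` is surjective. [cite: RibesZalesskii2010, §3.3] -/
theorem abMod_surjective (e : ℕ) : Function.Surjective (abMod p e) := by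
  intro x
  obtain ⟨u, hu⟩ := ZMod.intCast_surjective x.toAdd.1
  obtain ⟨v, hv⟩ := ZMod.intCast_surjective x.toAdd.2
  obtain ⟨g, hg⟩ := ab_surjective p (ofAdd ((u : ℤ_[p]), (v : ℤ_[p])))
  refine ⟨g, ?_⟩
  rw [abMod_apply, hg, toAdd_ofAdd, map_intCast, map_intCast, hu, hv]
  rfl

/-- The kernel of `abMod e` is open. [cite: RibesZalesskii2010, §3.3] -/
theorem isOpen_ker_abMod (e : ℕ) : IsOpen ((abMod p e).toMonoidHom.ker : Set (Grp p)) := by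
  change IsOpen ((abMod p e) ⁻¹' {1})
  exact (isOpen_discrete _).preimage (abMod p e).continuous

/-- **The level-`pᵉ` character `χaMod e : F̂₂⁽ᵖ⁾ → ℤ/pᵉ`**, `a ↦ 1`, `b ↦ 0` (first coordinate of
`abMod e`). [cite: RibesZalesskii2010, §3.3] -/
def χaMod (e : ℕ) : Grp p →ₜ* Multiplicative (ZMod (p ^ e)) where
  toFun g := ofAdd (abMod p e g).toAdd.1
  map_one' := by simp
  map_mul' x y := by simp [ofAdd_add]
  continuous_toFun :=
    continuous_ofAdd.comp (continuous_fst.comp (continuous_toAdd.comp (abMod p e).continuous))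

/-- Formula for `χaMod`. [cite: RibesZalesskii2010, §3.3] -/
theorem χaMod_apply (e : ℕ) (g : Grp p) :
    χaMod p e g = ofAdd (PadicInt.toZModPow e (χa p g).toAdd) := rfl

/-- `χaMod e a = 1`. [cite: RibesZalesskii2010, §3.3] -/
@[simp] theorem χaMod_a (e : ℕ) : χaMod p e (a p) = ofAdd 1 := by
  simp [χaMod_apply]

/-- `χaMod e b = 0`. [cite: RibesZalesskii2010, §3.3] -/
@[simp] theorem χaMod_b (e : ℕ) : χaMod p e (b p) = 1 := by
  simp [χaMod_apply]

/-- `χaMod e (α t) = t mod pᵉ`. [cite: RibesZalesskii2010, §3.3] -/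
theorem χaMod_α (e : ℕ) (t : Multiplicative ℤ_[p]) :
    χaMod p e (α p t) = ofAdd (PadicInt.toZModPow e t.toAdd) := by
  rw [χaMod_apply, χa_α]

/-- **`χaMod e` is `θₙ`-invariant**: `χaMod e (θₙ g) = χaMod e g` (so the level characters at the
vertices of the ray `𝒢_θ` glue along the twisted edges). [cite: RibesZalesskii2010, §3.3] -/
@[simp] theorem χaMod_θ (e n : ℕ) (g : Grp p) : χaMod p e (θ p n g) = χaMod p e g := by
  rw [χaMod_apply, χa_θ, χaMod_apply]

/-- `χaMod e (θₙ (α t)) = t mod pᵉ`. [cite: RibesZalesskii2010, §3.3] -/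
theorem χaMod_θ_α (e n : ℕ) (t : Multiplicative ℤ_[p]) :
    χaMod p e (θ p n (α p t)) = ofAdd (PadicInt.toZModPow e t.toAdd) := by
  rw [χaMod_θ, χaMod_α]

/-- `χaMod e` is surjective. [cite: RibesZalesskii2010, §3.3] -/
theorem χaMod_surjective (e : ℕ) : Function.Surjective (χaMod p e) := by
  intro x
  obtain ⟨u, hu⟩ := ZMod.intCast_surjective x.toAdd
  refine ⟨α p (ofAdd (u : ℤ_[p])), ?_⟩
  rw [χaMod_α, toAdd_ofAdd, map_intCast, hu]
  rfl

/-- The kernel of `χaMod e` is open. [cite: RibesZalesskii2010, §3.3] -/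
theorem isOpen_ker_χaMod (e : ℕ) : IsOpen ((χaMod p e).toMonoidHom.ker : Set (Grp p)) := by
  change IsOpen ((χaMod p e) ⁻¹' {1})
  exact (isOpen_discrete _).preimage (χaMod p e).continuous

/-- `α t` lies in the kernel of `χaMod e` iff `t ∈ pᵉ ℤ_p`. [cite: RibesZalesskii2010, §3.3] -/
theorem χaMod_α_eq_one_iff (e : ℕ) (t : Multiplicative ℤ_[p]) :
    χaMod p e (α p t) = 1 ↔ t.toAdd ∈ Ideal.span {(p : ℤ_[p]) ^ e} := by
  rw [χaMod_α, ← PadicInt.ker_toZModPow, RingHom.mem_ker]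
  constructor
  · intro h
    exact ofAdd_eq_one.mp h
  · intro h
    rw [h]
    rfl

/-! ### The (c5) separation at a level `e > m` -/

/-- `pᵐ ≠ 0` in `ℤ/pᵉ` for `m < e`. [cite: RibesZalesskii2010, §3.3] -/
theorem prime_pow_natCast_ne_zero {e m : ℕ} (h : m < e) : (p : ZMod (p ^ e)) ^ m ≠ 0 := by
  rw [← Nat.cast_pow, ne_eq, ZMod.natCast_eq_zero_iff]
  intro hdvd
  exact absurd (Nat.le_of_dvd (pow_pos hp.out.pos m) hdvd)
    (not_le.mpr (Nat.pow_lt_pow_right hp.out.one_lt h))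

/-- **Separation of the two gluings at a level `e > m`** (the arithmetic of the (c5) step of the
countermodel `𝒢_θ`): if `θₘ (α t₁)` and `α t₂` both have the same level-`pᵉ` character as `α 1 = a`,
their level-`pᵉ` abelianisations differ — `(1, pᵐ) ≠ (1, 0)` in `(ℤ/pᵉ)²`.
[cite: RibesZalesskii2010, §3.3] -/
theorem abMod_θ_α_ne_abMod_α_of_lt {e m : ℕ} (h : m < e) (t₁ t₂ : Multiplicative ℤ_[p])
    (h₁ : χaMod p e (θ p m (α p t₁)) = χaMod p e (α p (ofAdd 1)))
    (h₂ : χaMod p e (α p t₂) = χaMod p e (α p (ofAdd 1))) :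
    abMod p e (θ p m (α p t₁)) ≠ abMod p e (α p t₂) := by
  rw [χaMod_θ_α, α_ofAdd_one, χaMod_a] at h₁
  rw [χaMod_α, α_ofAdd_one, χaMod_a] at h₂
  have ht₁ : PadicInt.toZModPow e t₁.toAdd = 1 := Multiplicative.ofAdd.injective h₁
  have ht₂ : PadicInt.toZModPow e t₂.toAdd = 1 := Multiplicative.ofAdd.injective h₂
  rw [abMod_θ_α, abMod_α, ht₁, ht₂, mul_one]
  intro hEq
  have h2 := congrArg (fun x : Multiplicative (ZMod (p ^ e) × ZMod (p ^ e)) => x.toAdd.2) hEq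
  simp only [toAdd_ofAdd] at h2
  exact prime_pow_natCast_ne_zero p h h2

/-! ### The level kernels: indices and the characteristic open cores (appended) -/

section LevelKernels

/-- `[F̂₂⁽ᵖ⁾ : ker (abMod e)] = p^(2e)`. [cite: RibesZalesskii2010, §3.3] -/
theorem index_ker_abMod (e : ℕ) : (abMod p e).toMonoidHom.ker.index = p ^ (2 * e) := by
  rw [Subgroup.index_ker, MonoidHom.range_eq_top.mpr (abMod_surjective p e), Subgroup.card_top,
    Nat.card_congr Multiplicative.toAdd, Nat.card_prod, Nat.card_zmod, ← pow_add, two_mul]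

/-- `[F̂₂⁽ᵖ⁾ : ker (χaMod e)] = p^e`. [cite: RibesZalesskii2010, §3.3] -/
theorem index_ker_χaMod (e : ℕ) : (χaMod p e).toMonoidHom.ker.index = p ^ e := by
  rw [Subgroup.index_ker, MonoidHom.range_eq_top.mpr (χaMod_surjective p e), Subgroup.card_top,
    Nat.card_congr Multiplicative.toAdd, Nat.card_zmod]

/-- `ker (abMod e)` has finite index. [cite: RibesZalesskii2010, §3.3] -/
theorem finiteIndex_ker_abMod (e : ℕ) : (abMod p e).toMonoidHom.ker.FiniteIndex :=
  ⟨by rw [index_ker_abMod]; exact pow_ne_zero _ hp.out.ne_zero⟩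

/-- `ker (χaMod e)` has finite index. [cite: RibesZalesskii2010, §3.3] -/
theorem finiteIndex_ker_χaMod (e : ℕ) : (χaMod p e).toMonoidHom.ker.FiniteIndex :=
  ⟨by rw [index_ker_χaMod]; exact pow_ne_zero _ hp.out.ne_zero⟩

/-- **The characteristic open core of level `p^(2e)` lies in `ker (abMod e)`** (cofinality of the
characteristic open cores; the "group half" of the level-kernel binder `hK` of the countermodel).
[cite: DixonEtAl1999, Prop 1.6] -/
theorem charOpenCore_le_ker_abMod (e : ℕ) :
    charOpenCore (Grp p) (p ^ (2 * e)) ≤ (abMod p e).toMonoidHom.ker := by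
  haveI := finiteIndex_ker_abMod p e
  have h := charOpenCore_le_of_finiteIndex ((abMod p e).toMonoidHom.ker) (isOpen_ker_abMod p e)
  rwa [index_ker_abMod] at h

/-- The characteristic open core of level `p^e` lies in `ker (χaMod e)`. [cite: DixonEtAl1999, Prop 1.6] -/
theorem charOpenCore_le_ker_χaMod (e : ℕ) :
    charOpenCore (Grp p) (p ^ e) ≤ (χaMod p e).toMonoidHom.ker := by
  haveI := finiteIndex_ker_χaMod p e
  have h := charOpenCore_le_of_finiteIndex ((χaMod p e).toMonoidHom.ker) (isOpen_ker_χaMod p e)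
  rwa [index_ker_χaMod] at h

/-- Elements of the characteristic open core of level `p^(2e)` have trivial level-`p^e` abelianisation.
[cite: DixonEtAl1999, Prop 1.6] -/
theorem abMod_eq_one_of_mem_charOpenCore {e : ℕ} {g : Grp p} (hg : g ∈ charOpenCore (Grp p) (p ^ (2 * e))) :
    abMod p e g = 1 :=
  (MonoidHom.mem_ker).mp (charOpenCore_le_ker_abMod p e hg)

end LevelKernels

end Literature.AnabelianGeometry.SemiGraphs.FreeProPRankTwo

end
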